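import Literature.MathematicalPhysics.QuantumManyBody.PeriodicConfigFourier
import Literature.Analysis.FunctionSpaces.TorusPairDist
import HarnessLib

/-!
# The hard-core tube read on the unit torus: nearest-image distance and where `W = +∞`

`Literature/MathematicalPhysics/QuantumManyBody` support file (everything proved; no definitions, no
named facts), namespace `Literature.MathematicalPhysics.QuantumManyBody.BoseGas`. The dictionary
between the cell picture of the periodic Bose gas (`fromUnitTorusN L t : Config N`, the
representative of a point `t ∈ (ℝ/ℤ)^{N×3}` in `(0, L]^{3N}`; `periodizedPotential v L`,
`periodicInteraction v L`, `PeriodicBoseGas`/`PeriodicConfigFourier`) and the nearest-image pair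
distance `Torus.pairDist i j t = (∑ₖ ‖t(i,k) - t(j,k)‖²)^{1/2}` of `TorusPairDist`:

* `norm_sub_sub_latticeVec_ge` / `exists_norm_sub_sub_latticeVec_eq` — for `X = fromUnitTorusN L t`,
  `min_{n ∈ ℤ³} |Xᵢ - Xⱼ - Ln| = L · pairDist i j t` (`0 < L`): every image is at least this far and
  the image `nₖ = round(X̃ᵢₖ - X̃ⱼₖ)` realises it (`‖↑x‖_{ℝ/ℤ} = |x - round x| ≤ |x - m|`, `round_le`);
* `periodizedPotential_eq_top_of_pairDist_le` — if `v = +∞` on `[0, a]` (hard core of radius `a`)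
  and `L · pairDist i j t ≤ a` then `v^per(Xᵢ - Xⱼ) = +∞`, hence
  `periodicInteraction_eq_top_of_pairDist_le`: `W(fromUnitTorusN L t) = +∞` as soon as some pair
  `i < j` has `L · pairDist i j t ≤ a`;
* `periodizedPotential_eq_of_lt_pairDist` / `periodicInteraction_eq_of_lt_pairDist` /
  `periodicInteraction_mul_eq_of_vanish` — off the tubes (`a < L · pairDist`) the interaction of `v`
  equals that of any profile `v'` agreeing with `v` on `(a, ∞)` (the integrable tail);
* `ae_eq_zero_of_lintegral_periodicInteraction_mul_ne_top` — **finite potential energy keeps the wave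
  function off the tube**: if `∫⁻ W(fromUnitTorusN L t) ‖η t‖² dt < ∞` then `η = 0` a.e. on
  `{t : ∃ i < j, L · pairDist i j t ≤ a}` (in the form consumed by the cut-off files
  `TorusHardCoreCutoff*` and the tube Hardy inequality `TorusPairTubeHardy`, with `r = a/L`).

## Mathlib / tree search

Tree: `fromUnitTorusN`, `toUnitTorusN_fromUnitTorusN`, `fromUnitTorus`, `latticeVec`,
`periodizedPotential`, `periodicInteraction` (QuantumManyBody), `Torus.pairDist` (FunctionSpaces);
Mathlib: `AddCircle.coe_equivIoc` (the lift projects back: `↑(L⁻¹ Xᵢₖ) = t(i,k)` in `ℝ/ℤ`; used directly,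
the former in-file restatement `coe_equivIoc_eq` was removed, dedup-02625), `UnitAddCircle.norm_eq`,
`round_le`, `EuclideanSpace.norm_eq`, `ENNReal.tsum_eq_top_of_eq_top`, `MeasureTheory.ae_lt_top'`.

## References

* E. H. Lieb, R. Seiringer, J. P. Solovej, J. Yngvason, *The Mathematics of the Bose Gas and its
  Condensation*, Birkhäuser (2005), Ch. 2 (hard cores in a periodic box, nearest image).
-/

noncomputable section

open MeasureTheory Filter Set WithLp UnitAddTorus
open scoped ENNReal NNReal Topology
open Literature.Analysis.FunctionSpaces

namespace Literature.MathematicalPhysics.QuantumManyBody.BoseGas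

variable {N : ℕ}

/-! ## The nearest-image distance of a pair -/

/-- The lift `X̃ᵢₖ = L⁻¹ (fromUnitTorusN L t i) k ∈ (0, 1]` of the coordinate `t(i,k)` (private copy of
`HardLayerAux.fromUnitTorusN_apply_apply` of `BoseGasPairVolume`, whose coordinate-line import chain is not needed
here). [folklore] -/
private theorem fromUnitTorusN_apply_apply (L : ℝ) (t : UnitAddTorus (Fin N × Fin 3)) (i : Fin N) (k : Fin 3) :
    fromUnitTorusN L t i k = L * ((AddCircle.equivIoc 1 0 (t (i, k)) : ℝ)) := by
  rw [fromUnitTorusN_apply]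
  rfl

/-- The `k`-th component of `Xᵢ - Xⱼ - Ln` is `L (X̃ᵢₖ - X̃ⱼₖ - nₖ)`. [folklore] -/
theorem sub_sub_latticeVec_apply (L : ℝ) (t : UnitAddTorus (Fin N × Fin 3)) (i j : Fin N) (n : Fin 3 → ℤ)
    (k : Fin 3) :
    (fromUnitTorusN L t i - fromUnitTorusN L t j - latticeVec L n) k =
      L * (((AddCircle.equivIoc 1 0 (t (i, k))) : ℝ) - ((AddCircle.equivIoc 1 0 (t (j, k))) : ℝ) - n k) := by
  simp only [PiLp.sub_apply, fromUnitTorusN_apply_apply, latticeVec]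
  ring

/-- **Every image is at least `L · pairDist` away**: `L · pairDist i j t ≤ |Xᵢ - Xⱼ - Ln|` for all
`n ∈ ℤ³` (`X = fromUnitTorusN L t`, `0 ≤ L`). [folklore] -/
theorem norm_sub_sub_latticeVec_ge {L : ℝ} (hL : 0 ≤ L) (t : UnitAddTorus (Fin N × Fin 3)) (i j : Fin N)
    (n : Fin 3 → ℤ) :
    L * Torus.pairDist i j t ≤ ‖fromUnitTorusN L t i - fromUnitTorusN L t j - latticeVec L n‖ := by
  rw [EuclideanSpace.norm_eq, Torus.pairDist]
  have hfac : ∑ k, ‖(fromUnitTorusN L t i - fromUnitTorusN L t j - latticeVec L n) k‖ ^ 2 =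
      L ^ 2 * ∑ k, (((AddCircle.equivIoc 1 0 (t (i, k))) : ℝ) - ((AddCircle.equivIoc 1 0 (t (j, k))) : ℝ) - n k) ^ 2 := by
    rw [Finset.mul_sum]
    refine Finset.sum_congr rfl fun k _ => ?_
    rw [sub_sub_latticeVec_apply, Real.norm_eq_abs, sq_abs]
    ring
  rw [hfac, Real.sqrt_mul' _ (Finset.sum_nonneg fun _ _ => sq_nonneg _), Real.sqrt_sq hL]
  refine mul_le_mul_of_nonneg_left (Real.sqrt_le_sqrt (Finset.sum_le_sum fun k _ => ?_)) hL
  -- `‖t(i,k) - t(j,k)‖ ≤ |X̃ᵢₖ - X̃ⱼₖ - nₖ|`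
  have hcoe : t (i, k) - t (j, k) =
      (((((AddCircle.equivIoc 1 0 (t (i, k))) : ℝ) - ((AddCircle.equivIoc 1 0 (t (j, k))) : ℝ) - n k : ℝ)) :
        UnitAddCircle) := by
    rw [AddCircle.coe_sub, AddCircle.coe_sub, AddCircle.coe_equivIoc, AddCircle.coe_equivIoc, eq_comm,
      sub_eq_self, AddCircle.coe_eq_zero_iff]
    exact ⟨n k, by simp⟩
  rw [hcoe]
  exact (pow_le_pow_left₀ (norm_nonneg _) (UnitAddCircle.norm_coe_le_abs _) 2).trans_eq (sq_abs _)

/-- **The nearest image realises `L · pairDist`**: there is `n ∈ ℤ³` with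
`|Xᵢ - Xⱼ - Ln| = L · pairDist i j t` (`nₖ = round(X̃ᵢₖ - X̃ⱼₖ)`; `0 ≤ L`). [folklore] -/
theorem exists_norm_sub_sub_latticeVec_eq {L : ℝ} (hL : 0 ≤ L) (t : UnitAddTorus (Fin N × Fin 3)) (i j : Fin N) :
    ∃ n : Fin 3 → ℤ, ‖fromUnitTorusN L t i - fromUnitTorusN L t j - latticeVec L n‖ = L * Torus.pairDist i j t := by
  set d : Fin 3 → ℝ := fun k => ((AddCircle.equivIoc 1 0 (t (i, k))) : ℝ) - ((AddCircle.equivIoc 1 0 (t (j, k))) : ℝ)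
    with hd
  refine ⟨fun k => round (d k), ?_⟩
  rw [EuclideanSpace.norm_eq, Torus.pairDist]
  have hfac : ∑ k, ‖(fromUnitTorusN L t i - fromUnitTorusN L t j - latticeVec L fun k => round (d k)) k‖ ^ 2 =
      L ^ 2 * ∑ k, (d k - round (d k)) ^ 2 := by
    rw [Finset.mul_sum]
    refine Finset.sum_congr rfl fun k _ => ?_
    rw [sub_sub_latticeVec_apply, Real.norm_eq_abs, sq_abs]
    simp only [hd]
    ring
  rw [hfac, Real.sqrt_mul' _ (Finset.sum_nonneg fun _ _ => sq_nonneg _), Real.sqrt_sq hL]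
  congr 2
  refine Finset.sum_congr rfl fun k _ => ?_
  have hcoe : t (i, k) - t (j, k) = ((d k : ℝ) : UnitAddCircle) := by
    simp only [hd]
    rw [AddCircle.coe_sub, AddCircle.coe_equivIoc, AddCircle.coe_equivIoc]
  rw [hcoe, UnitAddCircle.norm_eq, sq_abs]

/-! ## Hard cores: where the periodic interaction is `+∞` -/

/-- **The periodised hard-core potential is `+∞` on the tube**: if `v = +∞` on `[0, a]` and
`L · pairDist i j t ≤ a` (`0 ≤ L`), then `v^per(Xᵢ - Xⱼ) = +∞` for `X = fromUnitTorusN L t`.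
[folklore] -/
theorem periodizedPotential_eq_top_of_pairDist_le {v : ℝ → ℝ≥0∞} {a : ℝ}
    (hv : ∀ ρ : ℝ, 0 ≤ ρ → ρ ≤ a → v ρ = ⊤) {L : ℝ} (hL : 0 ≤ L) (t : UnitAddTorus (Fin N × Fin 3)) {i j : Fin N}
    (hij : L * Torus.pairDist i j t ≤ a) :
    periodizedPotential v L (fromUnitTorusN L t i - fromUnitTorusN L t j) = ⊤ := by
  obtain ⟨n, hn⟩ := exists_norm_sub_sub_latticeVec_eq hL t i j
  refine ENNReal.tsum_eq_top_of_eq_top ⟨n, ?_⟩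
  rw [hn]
  exact hv _ (mul_nonneg hL (Torus.pairDist_nonneg i j t)) hij

/-- **The periodic interaction is `+∞` on the tubes**: if `v = +∞` on `[0, a]` and some pair
`i < j` has `L · pairDist i j t ≤ a`, then `W(fromUnitTorusN L t) = +∞`. [folklore] -/
theorem periodicInteraction_eq_top_of_pairDist_le {v : ℝ → ℝ≥0∞} {a : ℝ}
    (hv : ∀ ρ : ℝ, 0 ≤ ρ → ρ ≤ a → v ρ = ⊤) {L : ℝ} (hL : 0 ≤ L) (t : UnitAddTorus (Fin N × Fin 3)) {i j : Fin N}
    (hlt : i < j) (hij : L * Torus.pairDist i j t ≤ a) :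
    periodicInteraction v L (fromUnitTorusN L t) = ⊤ := by
  unfold periodicInteraction
  refine ENNReal.sum_eq_top.2 ⟨i, Finset.mem_univ _, ?_⟩
  exact ENNReal.sum_eq_top.2 ⟨j, Finset.mem_filter.2 ⟨Finset.mem_univ _, hlt⟩,
    periodizedPotential_eq_top_of_pairDist_le hv hL t hij⟩

/-! ## Finite potential energy keeps the wave function off the tubes -/

/-- Generic: if `∫⁻ F ‖η‖² < ∞` then `η = 0` a.e. where `F = +∞`. [folklore] -/
theorem ae_eq_zero_of_lintegral_top_mul_ne_top {α : Type*} [MeasurableSpace α] {μ : Measure α}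
    {E : Type*} [NormedAddCommGroup E] {F : α → ℝ≥0∞} {η : α → E} (hF : AEMeasurable F μ)
    (hη : AEStronglyMeasurable η μ) (hfin : ∫⁻ x, F x * ‖η x‖ₑ ^ 2 ∂μ ≠ ⊤) :
    ∀ᵐ x ∂μ, F x = ⊤ → η x = 0 := by
  have hae := ae_lt_top' (f := fun x => F x * ‖η x‖ₑ ^ 2) (hF.mul (hη.enorm.pow_const 2)) hfin
  filter_upwards [hae] with x hx hFx
  by_contra hne
  have hpos : ‖η x‖ₑ ^ 2 ≠ 0 := pow_ne_zero _ (by rwa [Ne, enorm_eq_zero])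
  have hx' : F x * ‖η x‖ₑ ^ 2 < ⊤ := hx
  rw [hFx, ENNReal.top_mul hpos] at hx'
  exact lt_irrefl _ hx'

/-- `t ↦ W(fromUnitTorusN L t)` is measurable for a measurable profile. [folklore] -/
theorem measurable_periodicInteraction_comp_fromUnitTorusN {v : ℝ → ℝ≥0∞} (hv : Measurable v) (L : ℝ) :
    Measurable fun t : UnitAddTorus (Fin N × Fin 3) => periodicInteraction v L (fromUnitTorusN L t) := by
  have hp : Measurable (periodizedPotential v L) := by
    show Measurable fun x => ∑' n : Fin 3 → ℤ, v ‖x - latticeVec L n‖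
    simp_rw [ENNReal.tsum_eq_iSup_sum]
    exact Measurable.iSup fun s => Finset.measurable_sum s fun n _ => hv.comp (measurable_id.sub_const _).norm
  have hW : Measurable fun X : Config N => periodicInteraction v L X := by
    unfold periodicInteraction
    refine Finset.measurable_sum _ fun i _ => Finset.measurable_sum _ fun j _ => ?_
    exact hp.comp ((measurable_pi_apply i).sub (measurable_pi_apply j))
  exact hW.comp (measurable_fromUnitTorusN L)

/-- **Finite hard-core energy forces vanishing on the tubes.** If `v = +∞` on `[0, a]`, `0 ≤ L`,
`η : (ℝ/ℤ)^{N×3} → E` is a.e.-strongly measurable and `∫⁻ W(fromUnitTorusN L t) ‖η t‖² dt < ∞`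
(`W = periodicInteraction v L`), then `η t = 0` for a.e. `t` with `L · pairDist i j t ≤ a` for
some `i < j`. [folklore] -/
theorem ae_eq_zero_of_lintegral_periodicInteraction_mul_ne_top {v : ℝ → ℝ≥0∞} (hvm : Measurable v) {a : ℝ}
    (hv : ∀ ρ : ℝ, 0 ≤ ρ → ρ ≤ a → v ρ = ⊤) {L : ℝ} (hL : 0 ≤ L) {E : Type*} [NormedAddCommGroup E]
    {η : UnitAddTorus (Fin N × Fin 3) → E} (hη : AEStronglyMeasurable η volume)
    (hfin : ∫⁻ t, periodicInteraction v L (fromUnitTorusN L t) * ‖η t‖ₑ ^ 2 ≠ ⊤) :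
    ∀ᵐ t ∂(volume : Measure (UnitAddTorus (Fin N × Fin 3))),
      (∃ i j : Fin N, i < j ∧ L * Torus.pairDist i j t ≤ a) → η t = 0 := by
  have hW := measurable_periodicInteraction_comp_fromUnitTorusN (N := N) hvm L
  filter_upwards [ae_eq_zero_of_lintegral_top_mul_ne_top hW.aemeasurable hη hfin] with t ht hex
  obtain ⟨i, j, hij, hle⟩ := hex
  exact ht (periodicInteraction_eq_top_of_pairDist_le hv hL t hij hle)

/-! ## Off the tubes the hard core is invisible -/

/-- **Off the tube the periodised potential only sees the tail**: if `v` and `v'` agree on `(a, ∞)`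
and `a < L · pairDist i j t` (`0 ≤ L`), then `v^per(Xᵢ - Xⱼ) = v'^per(Xᵢ - Xⱼ)` for
`X = fromUnitTorusN L t` (every image is at distance `≥ L · pairDist > a`). [folklore] -/
theorem periodizedPotential_eq_of_lt_pairDist {v v' : ℝ → ℝ≥0∞} {a : ℝ} (hvv' : ∀ ρ : ℝ, a < ρ → v ρ = v' ρ)
    {L : ℝ} (hL : 0 ≤ L) (t : UnitAddTorus (Fin N × Fin 3)) {i j : Fin N} (hij : a < L * Torus.pairDist i j t) :
    periodizedPotential v L (fromUnitTorusN L t i - fromUnitTorusN L t j) =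
      periodizedPotential v' L (fromUnitTorusN L t i - fromUnitTorusN L t j) := by
  show (∑' n : Fin 3 → ℤ, v ‖fromUnitTorusN L t i - fromUnitTorusN L t j - latticeVec L n‖) =
    ∑' n : Fin 3 → ℤ, v' ‖fromUnitTorusN L t i - fromUnitTorusN L t j - latticeVec L n‖
  exact tsum_congr fun n => hvv' _ (hij.trans_le (norm_sub_sub_latticeVec_ge hL t i j n))

/-- **Off all tubes the interaction only sees the tail**: if `v` and `v'` agree on `(a, ∞)` and every
pair `i < j` has `a < L · pairDist i j t`, then `W_v(fromUnitTorusN L t) = W_{v'}(fromUnitTorusN L t)`.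
[folklore] -/
theorem periodicInteraction_eq_of_lt_pairDist {v v' : ℝ → ℝ≥0∞} {a : ℝ} (hvv' : ∀ ρ : ℝ, a < ρ → v ρ = v' ρ)
    {L : ℝ} (hL : 0 ≤ L) (t : UnitAddTorus (Fin N × Fin 3))
    (ht : ∀ i j : Fin N, i < j → a < L * Torus.pairDist i j t) :
    periodicInteraction v L (fromUnitTorusN L t) = periodicInteraction v' L (fromUnitTorusN L t) := by
  unfold periodicInteraction
  refine Finset.sum_congr rfl fun i _ => Finset.sum_congr rfl fun j hj => ?_
  exact periodizedPotential_eq_of_lt_pairDist hvv' hL t (ht i j (Finset.mem_filter.1 hj).2)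

/-- **The potential energy density of a function vanishing near the tubes only sees the tail.** If
`v` and `v'` agree on `(a, ∞)`, `0 ≤ L`, and at every `t` either `F t = 0` or all pairs `i < j` have
`a < L ρᵢⱼ(t)`, then `W_v(fromUnitTorusN L t) · F t = W_{v'}(fromUnitTorusN L t) · F t`. [folklore] -/
theorem periodicInteraction_mul_eq_of_vanish {v v' : ℝ → ℝ≥0∞} {a : ℝ} (hvv' : ∀ ρ : ℝ, a < ρ → v ρ = v' ρ)
    {L : ℝ} (hL : 0 ≤ L) {F : UnitAddTorus (Fin N × Fin 3) → ℝ≥0∞}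
    (hF : ∀ t, F t = 0 ∨ ∀ i j : Fin N, i < j → a < L * Torus.pairDist i j t) (t : UnitAddTorus (Fin N × Fin 3)) :
    periodicInteraction v L (fromUnitTorusN L t) * F t = periodicInteraction v' L (fromUnitTorusN L t) * F t := by
  rcases hF t with h | h
  · rw [h, mul_zero, mul_zero]
  · rw [periodicInteraction_eq_of_lt_pairDist hvv' hL t h]

end Literature.MathematicalPhysics.QuantumManyBody.BoseGas

end
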